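/-
Origin: expansion seat `planner-pub-hodgecm-toy-0`, handover #2 2026-08-18T04:13:45Z (`HOME/pub-hodgecm-toy/lean/Toy/CMIdempotent.lean`, md5 46a1969b, 271 lines);
landed by the gen-5 packager in gate run 21 as `HodgeCM/Model/Toy/CMIdempotent.lean` (verbatim).
-/
-- HANDOVER (planner-pub-hodgecm-toy-0, unit pub-hodgecm-toy): WIP module `Toy.CMIdempotent`; intended final module
-- `HodgeCM.Model.Toy.CMIdempotent` (kind L5, toy model / consistency witness); rename `import Toy.X` ↦ the final prefix.
/-
Copyright: pub-hodgecm cell (HodgeCMPerL). Consistency-witness layer (part (e), referee A G4).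

# CM idempotents in `ℂ ⊗[ℚ] F`

For a number field `F` and an embedding `σ : F →+* ℂ` we construct the idempotent `eps σ ∈ ℂ ⊗[ℚ] F`
cutting out the `σ`-eigenline of the regular representation, **explicitly**:
`eps σ = ∑ i, σ (d i) ⊗ b i` where `b` is a `ℚ`-basis of `F` and `d` its dual basis for the trace form.
Everything here is finite linear algebra over `ℚ`/`ℂ`; it is the engine of the toy model `HodgeCM.Toy.Model`.
-/
import Mathlib
import Literature.AlgebraicGeometry.Motives.HodgeStructure

/-! PORT of `HodgeCM/Model/Toy/CMIdempotent.lean` (HodgeCMPerL run 81) — verbatim mechanical port; provenance in the PORT header line. -/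

open scoped TensorProduct ComplexConjugate

namespace HodgeCM.Toy

noncomputable section

variable (F : Type*) [Field F] [NumberField F]

/-- The trace form of `F/ℚ`. -/
abbrev trB : LinearMap.BilinForm ℚ F := Algebra.traceForm ℚ F

/-- (Ported verbatim from the HodgeCMPerL package; no docstring in the source.) -/
lemma trB_nondegenerate : (trB F).Nondegenerate := traceForm_nondegenerate ℚ F

/-- A fixed `ℚ`-basis of `F`. -/
def bF : Module.Basis (Fin (Module.finrank ℚ F)) ℚ F := Module.finBasis ℚ F

/-- The trace-dual basis: `Tr (dF i * bF j) = δ_{ij}`. -/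
def dF : Module.Basis (Fin (Module.finrank ℚ F)) ℚ F :=
  (trB F).dualBasis (trB_nondegenerate F) (bF F)

/-- (Ported verbatim from the HodgeCMPerL package; no docstring in the source.) -/
lemma trace_dF_mul_bF (i j : Fin (Module.finrank ℚ F)) :
    Algebra.trace ℚ F (dF F i * bF F j) = if j = i then 1 else 0 := by
  have := LinearMap.BilinForm.apply_dualBasis_left (trB_nondegenerate F) (bF F) i j
  simpa [dF, Algebra.traceForm_apply] using this

/-- Expansion in the dual basis: `x = ∑ i, Tr (x * b i) • d i`. -/
lemma dF_repr (x : F) (i : Fin (Module.finrank ℚ F)) :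
    (dF F).repr x i = Algebra.trace ℚ F (x * bF F i) := by
  simp [dF, LinearMap.BilinForm.dualBasis_repr_apply, Algebra.traceForm_apply]

/-- Expansion in the basis `b`: `x = ∑ i, Tr (d i * x) • b i`. -/
lemma bF_repr (x : F) (i : Fin (Module.finrank ℚ F)) :
    (bF F).repr x i = Algebra.trace ℚ F (dF F i * x) := by
  have h := LinearMap.BilinForm.dualBasis_flip_dualBasis (trB_nondegenerate F) (bF F)
  -- `b` is the dual basis of `d` for the flipped (= same) form
  have : (bF F).repr x i = ((trB F).flip.dualBasis
      (LinearMap.BilinForm.Nondegenerate.flip (trB_nondegenerate F)) (dF F)).repr x i := by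
    rw [show (trB F).flip.dualBasis _ (dF F) = bF F from h]
  rw [this, LinearMap.BilinForm.dualBasis_repr_apply]
  simp [Algebra.traceForm_apply, mul_comm]

/-- (Ported verbatim from the HodgeCMPerL package; no docstring in the source.) -/
lemma sum_trace_mul_bF_smul_dF (x : F) :
    ∑ i, Algebra.trace ℚ F (x * bF F i) • dF F i = x := by
  conv_rhs => rw [← (dF F).sum_repr x]
  simp [dF_repr]

/-- (Ported verbatim from the HodgeCMPerL package; no docstring in the source.) -/
lemma sum_trace_dF_mul_smul_bF (x : F) :
    ∑ i, Algebra.trace ℚ F (dF F i * x) • bF F i = x := by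
  conv_rhs => rw [← (bF F).sum_repr x]
  simp [bF_repr]

/-- The `σ`-idempotent. -/
def eps (σ : F →+* ℂ) : ℂ ⊗[ℚ] F := ∑ i, (σ (dF F i)) ⊗ₜ[ℚ] (bF F i)

variable {F}

/-- The trace as a sum over ring embeddings into `ℂ`. -/
lemma trace_eq_sum_ringHom (x : F) :
    ((Algebra.trace ℚ F x : ℚ) : ℂ) = ∑ σ : F →+* ℂ, σ x := by
  have h := trace_eq_sum_embeddings ℂ (K := ℚ) (L := F) (x := x)
  rw [eq_ratCast] at h
  rw [h]
  exact Fintype.sum_equiv (RingHom.equivRatAlgHom).symm _ _ (fun σ => rfl)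

/-- (E1) `eps σ` is a joint eigenvector of the regular representation with character `σ`. -/
lemma tmul_mul_eps (σ : F →+* ℂ) (k : F) :
    (1 ⊗ₜ[ℚ] k) * eps F σ = σ k • eps F σ := by
  classical
  unfold eps
  rw [Finset.mul_sum, Finset.smul_sum]
  -- expand `k * b i` in the basis `b`
  have hexp : ∀ i, k * bF F i = ∑ j, Algebra.trace ℚ F (dF F j * (k * bF F i)) • bF F j :=
    fun i => (sum_trace_dF_mul_smul_bF F (k * bF F i)).symm
  calc ∑ i, (1 : ℂ) ⊗ₜ[ℚ] k * (σ (dF F i) ⊗ₜ[ℚ] bF F i)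
      = ∑ i, σ (dF F i) ⊗ₜ[ℚ] (k * bF F i) := by
        refine Finset.sum_congr rfl fun i _ => ?_
        rw [Algebra.TensorProduct.tmul_mul_tmul, one_mul]
    _ = ∑ i, ∑ j, (Algebra.trace ℚ F (dF F j * (k * bF F i)) • σ (dF F i)) ⊗ₜ[ℚ] bF F j := by
        refine Finset.sum_congr rfl fun i _ => ?_
        conv_lhs => rw [hexp i]
        rw [TensorProduct.tmul_sum]
        refine Finset.sum_congr rfl fun j _ => ?_
        rw [TensorProduct.tmul_smul, TensorProduct.smul_tmul']
    _ = ∑ j, (∑ i, Algebra.trace ℚ F (dF F j * (k * bF F i)) • σ (dF F i)) ⊗ₜ[ℚ] bF F j := by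
        rw [Finset.sum_comm]
        refine Finset.sum_congr rfl fun j _ => ?_
        rw [TensorProduct.sum_tmul]
    _ = ∑ j, σ k • (σ (dF F j) ⊗ₜ[ℚ] bF F j) := by
        refine Finset.sum_congr rfl fun j _ => ?_
        have : ∑ i, Algebra.trace ℚ F (dF F j * (k * bF F i)) • σ (dF F i) = σ (dF F j * k) := by
          have h2 := congrArg σ (sum_trace_mul_bF_smul_dF F (dF F j * k))
          rw [map_sum] at h2
          rw [← h2]
          refine Finset.sum_congr rfl fun i _ => ?_
          rw [map_rat_smul, mul_assoc]
        rw [this, map_mul, TensorProduct.smul_tmul', smul_eq_mul, mul_comm]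

/-- (E2) the idempotents sum to `1`. -/
lemma sum_eps : ∑ σ : F →+* ℂ, eps F σ = 1 := by
  classical
  unfold eps
  rw [Finset.sum_comm]
  calc ∑ i, ∑ σ : F →+* ℂ, σ (dF F i) ⊗ₜ[ℚ] bF F i
      = ∑ i, ((Algebra.trace ℚ F (dF F i) : ℚ) : ℂ) ⊗ₜ[ℚ] bF F i := by
        refine Finset.sum_congr rfl fun i _ => ?_
        rw [← TensorProduct.sum_tmul, trace_eq_sum_ringHom]
    _ = ∑ i, (1 : ℂ) ⊗ₜ[ℚ] (Algebra.trace ℚ F (dF F i * 1) • bF F i) := by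
        refine Finset.sum_congr rfl fun i _ => ?_
        rw [mul_one, ← TensorProduct.smul_tmul, Rat.smul_one_eq_cast]
    _ = 1 := by
        rw [← TensorProduct.tmul_sum, sum_trace_dF_mul_smul_bF]
        rfl

omit [NumberField F] in
/-- Separating points: distinct embeddings differ somewhere. -/
lemma exists_apply_ne_of_ne {σ τ : F →+* ℂ} (h : σ ≠ τ) : ∃ k : F, σ k ≠ τ k := by
  by_contra hc
  push Not at hc
  exact h (RingHom.ext hc)

/-- Joint eigenvectors for distinct characters: if `x` transforms by `σ` under left multiplication by `F`
then `x * eps τ = 0` for `τ ≠ σ`. -/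
lemma mul_eps_eq_zero_of_ne {σ τ : F →+* ℂ} (h : σ ≠ τ) {x : ℂ ⊗[ℚ] F}
    (hx : ∀ k : F, (1 ⊗ₜ[ℚ] k) * x = σ k • x) : x * eps F τ = 0 := by
  obtain ⟨k, hk⟩ := exists_apply_ne_of_ne h
  have h1 : (1 ⊗ₜ[ℚ] k) * (x * eps F τ) = σ k • (x * eps F τ) := by
    rw [← mul_assoc, hx, smul_mul_assoc]
  have h2 : (1 ⊗ₜ[ℚ] k) * (x * eps F τ) = τ k • (x * eps F τ) := by
    rw [mul_left_comm, tmul_mul_eps, mul_smul_comm]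
  have : (σ k - τ k) • (x * eps F τ) = 0 := by rw [sub_smul, ← h1, ← h2, sub_self]
  rcases smul_eq_zero.mp this with h3 | h3
  · exact absurd (sub_eq_zero.mp h3) hk
  · exact h3

/-- Variant: an eigenvector of multiplication by one `1 ⊗ k` with eigenvalue `c ≠ τ k` is killed by `eps τ`. -/
lemma mul_eps_eq_zero_of_eigen {τ : F →+* ℂ} {x : ℂ ⊗[ℚ] F} {k : F} {c : ℂ}
    (hx : (1 ⊗ₜ[ℚ] k) * x = c • x) (hc : c ≠ τ k) : x * eps F τ = 0 := by
  have h1 : (1 ⊗ₜ[ℚ] k) * (x * eps F τ) = c • (x * eps F τ) := by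
    rw [← mul_assoc, hx, smul_mul_assoc]
  have h2 : (1 ⊗ₜ[ℚ] k) * (x * eps F τ) = τ k • (x * eps F τ) := by
    rw [mul_left_comm, tmul_mul_eps, mul_smul_comm]
  have : (c - τ k) • (x * eps F τ) = 0 := by rw [sub_smul, ← h1, ← h2, sub_self]
  rcases smul_eq_zero.mp this with h3 | h3
  · exact absurd (sub_eq_zero.mp h3) hc
  · exact h3

/-- (E3a) orthogonality. -/
lemma eps_mul_eps_of_ne {σ τ : F →+* ℂ} (h : σ ≠ τ) : eps F σ * eps F τ = 0 :=
  mul_eps_eq_zero_of_ne h (tmul_mul_eps σ)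

/-- (E3b) idempotency. -/
lemma eps_mul_eps (σ : F →+* ℂ) : eps F σ * eps F σ = eps F σ := by
  classical
  have : eps F σ * ∑ τ : F →+* ℂ, eps F τ = eps F σ := by rw [sum_eps, mul_one]
  rw [Finset.mul_sum, Finset.sum_eq_single σ] at this
  · exact this
  · intro τ _ hτ; exact eps_mul_eps_of_ne (Ne.symm hτ)
  · intro h; exact absurd (Finset.mem_univ σ) h

/-- The evaluation character `ℂ ⊗ F → ℂ`, `z ⊗ x ↦ z * σ x`. -/
def evalC (σ : F →+* ℂ) : ℂ ⊗[ℚ] F →ₐ[ℂ] ℂ :=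
  Algebra.TensorProduct.lift (AlgHom.id ℂ ℂ) (RingHom.equivRatAlgHom σ) (fun _ _ => Commute.all _ _)

/-- (Ported verbatim from the HodgeCMPerL package; no docstring in the source.) -/
@[simp] lemma evalC_tmul (σ : F →+* ℂ) (z : ℂ) (x : F) : evalC σ (z ⊗ₜ[ℚ] x) = z * σ x := by
  simp [evalC, Algebra.TensorProduct.lift_tmul]

/-- (Ported verbatim from the HodgeCMPerL package; no docstring in the source.) -/
lemma trace_sum_dF_mul_bF : Algebra.trace ℚ F (∑ i, dF F i * bF F i) = Module.finrank ℚ F := by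
  classical
  rw [map_sum]
  simp [trace_dF_mul_bF]

/-- (E3c) `eps σ ≠ 0`. -/
lemma eps_ne_zero (σ : F →+* ℂ) : eps F σ ≠ 0 := by
  classical
  intro h
  have h1 : evalC σ (eps F σ) = σ (∑ i, dF F i * bF F i) := by
    simp [eps, map_sum, evalC_tmul, map_mul]
  rw [h, map_zero] at h1
  have h2 : (∑ i, dF F i * bF F i) = 0 := by
    have := (map_eq_zero_iff σ σ.injective).mp h1.symm
    exact this
  have h3 := trace_sum_dF_mul_bF (F := F)
  rw [h2, map_zero] at h3
  have : (0 : ℚ) < Module.finrank ℚ F := by exact_mod_cast Module.finrank_pos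
  exact absurd h3.symm (ne_of_gt this)

/-- (E4) complex conjugation permutes the idempotents. -/
lemma conj_eps (σ : F →+* ℂ) :
    Literature.AlgebraicGeometry.Motives.HodgeStructure.conj (eps F σ)
      = eps F (NumberField.ComplexEmbedding.conjugate σ) := by
  classical
  simp only [eps, map_sum, Literature.AlgebraicGeometry.Motives.HodgeStructure.conj_tmul]
  rfl

/-- Left multiplication by `k ∈ F`, base-changed to `ℂ`, is multiplication by `1 ⊗ k` in the algebra `ℂ ⊗ F`. -/
lemma baseChange_mulLeft (k : F) (x : ℂ ⊗[ℚ] F) :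
    (LinearMap.mulLeft ℚ k).baseChange ℂ x = (1 ⊗ₜ[ℚ] k) * x := by
  induction x using TensorProduct.induction_on with
  | zero => simp
  | tmul z y => simp [Algebra.TensorProduct.tmul_mul_tmul]
  | add x y hx hy => simp [map_add, mul_add, hx, hy]

/-- Any element times `eps σ` lies on the line `ℂ • eps σ`. -/
lemma mul_eps_mem_span (σ : F →+* ℂ) (x : ℂ ⊗[ℚ] F) :
    x * eps F σ ∈ Submodule.span ℂ {eps F σ} := by
  induction x using TensorProduct.induction_on with
  | zero => simp
  | tmul z y =>
      have : z ⊗ₜ[ℚ] y * eps F σ = (z * σ y) • eps F σ := by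
        rw [show z ⊗ₜ[ℚ] y = z • ((1 : ℂ) ⊗ₜ[ℚ] y) by
              rw [TensorProduct.smul_tmul', smul_eq_mul, mul_one],
          smul_mul_assoc, tmul_mul_eps, smul_smul]
      rw [this]
      exact Submodule.smul_mem _ _ (Submodule.subset_span rfl)
  | add x y hx hy => rw [add_mul]; exact Submodule.add_mem _ hx hy

/-- Eigen-characterisation: a joint `σ`-eigenvector lies on the line `ℂ • eps σ`. -/
lemma mem_span_eps_of_eigen (σ : F →+* ℂ) {x : ℂ ⊗[ℚ] F}
    (hx : ∀ k : F, (1 ⊗ₜ[ℚ] k) * x = σ k • x) : x ∈ Submodule.span ℂ {eps F σ} := by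
  classical
  have : x = x * eps F σ := by
    have h1 : x * ∑ τ : F →+* ℂ, eps F τ = x := by rw [sum_eps, mul_one]
    rw [Finset.mul_sum, Finset.sum_eq_single σ] at h1
    · exact h1.symm
    · intro τ _ hτ; exact mul_eps_eq_zero_of_ne (Ne.symm hτ) hx
    · intro h; exact absurd (Finset.mem_univ σ) h
  rw [this]
  exact mul_eps_mem_span σ x

/-- Linear independence of the idempotents. -/
lemma linearIndependent_eps : LinearIndependent ℂ (fun σ : F →+* ℂ => eps F σ) := by
  classical
  rw [Fintype.linearIndependent_iff]
  intro c hc τ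
  have := congrArg (· * eps F τ) hc
  simp only [Finset.sum_mul, zero_mul, smul_mul_assoc] at this
  rw [Finset.sum_eq_single τ] at this
  · rw [eps_mul_eps] at this
    exact (smul_eq_zero.mp this).resolve_right (eps_ne_zero τ)
  · intro σ _ hσ; rw [eps_mul_eps_of_ne hσ, smul_zero]
  · intro h; exact absurd (Finset.mem_univ τ) h

/-- (Ported verbatim from the HodgeCMPerL package; no docstring in the source.) -/
lemma finrank_complex_tensor : Module.finrank ℂ (ℂ ⊗[ℚ] F) = Module.finrank ℚ F :=
  Module.finrank_baseChange

/-- The idempotents form a `ℂ`-basis of `ℂ ⊗ F`. -/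
def epsBasis : Module.Basis (F →+* ℂ) ℂ (ℂ ⊗[ℚ] F) :=
  basisOfLinearIndependentOfCardEqFinrank linearIndependent_eps
    (by rw [finrank_complex_tensor, NumberField.Embeddings.card])

/-- (Ported verbatim from the HodgeCMPerL package; no docstring in the source.) -/
@[simp] lemma epsBasis_apply (σ : F →+* ℂ) : epsBasis (F := F) σ = eps F σ := by
  simp [epsBasis]

end

end HodgeCM.Toy
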